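import Mathlib
import Summits.Ventures.HodgeRepro2.T5RamifiedNormAbove
import Summits.Ventures.HodgeRepro2.T5RamifiedNormEstimates

/-!
# Below the break (wild case): `U_F^{(t)} ⊄ N(E^×)` for `t = i − 1`, hence `f(η_v) ≥ i` (T5RamifiedNormBelow)

Setting as T5RamifiedNormAbove, now WILD: `2 ∉ O_{K_v}^×`. Then `f ≥ 2` (row 169) and `f ≤ i` (T5RamifiedNormAbove), so
`t := i − 1 ≥ 1`, and `i ≤ 2e + 1` (T5RamifiedBreak), so `t ≤ 2e` and `e ≥ 1`.

THE ARGUMENT (Serre, Local Fields V §3 Prop. 5 (i)–(ii) for a quadratic extension, made explicit):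
* `N(1 + x) − 1 = Tr x + N x` with `v(N x) = v(x)²` and `v(Tr x) ≤ exp(−m − t)` for `v(x) ≤ exp(−m)`
  (`Tr x = 2x + (σ x − x)`: `v(2x) ≤ exp(−2e − m)`, `v(σ x − x) ≤ exp(−m − t)`).
* KEY LEMMA 1: a unit `Y` of `L_w` whose norm lies in `U_F^{(t)}` lies in `U_E^{(t)}` (level `0 → 1` through the integral
  basis and `a² ≡ 1 ⇒ a ≡ 1 (mod 𝔪)` in residue characteristic `2`; level `m → m + 1` for `1 ≤ m < t` because
  `v(N(1 + x) − 1) = v(x)² = exp(−2m)` exactly when `v(x) = exp(−m)`).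
* KEY LEMMA 2: `Y ∈ U_E^{(t)}` factors as `(1 + alg c · z)(1 + x')` with `c ∈ O_{K_v}`, `v(x') ≤ exp(−(t+1))`, for a
  fixed `z` with `v(z) = exp(−t)`; KEY LEMMA 3: `N(1 + x') ∈ U_F^{(t+1)}`.
* Hence if `U_F^{(t)} ⊆ N(L_w^×)` then, with `A = Tr z`, `B = N z` (both of value `exp(−t)` for the `z` chosen in Case A /
  Case B of T5RamifiedBreak), every `1 + ϖ^t a₀` is `≡ 1 + c A + c² B (mod 𝔪^{t+1})`: the map
  `x ↦ ᾱ x + β̄ x²` on the residue field `k` (`α = A/ϖ^t`, `β = B/ϖ^t` units) is SURJECTIVE, hence injective (`k` finite),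
  but it kills `ᾱ/β̄ ≠ 0` in characteristic `2` — contradiction. So `U_F^{(t)} ⊄ N(L_w^×)` for any such `(z, A, B)`
  (`not_unitFiltration_le_normGroup_of_data`); the data and the conclusion **`i ≤ f`** are in T5WildConductor.
-/

namespace Summit.Ventures.HodgeRepro2.T5RamifiedNormBelow

open IsDedekindDomain HeightOneSpectrum
open Summit.Ventures.HodgeRepro2.T5RamifiedIntegralBasis Summit.Ventures.HodgeRepro2.T5RamifiedBreak
open Summit.Ventures.HodgeRepro2.T5NormCharConductor Summit.Ventures.HodgeRepro2.T5RamifiedNormAbove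
open Summit.Ventures.HodgeRepro2.T5RamifiedNormEstimates

variable {K : Type*} [Field K] [NumberField K] (v : HeightOneSpectrum (NumberField.RingOfIntegers K))
  {L : Type*} [Field L] [NumberField L] [Algebra K L] (w : HeightOneSpectrum (NumberField.RingOfIntegers L))
  [w.asIdeal.LiesOver v.asIdeal]
  [ContinuousSMul (v.adicCompletion K) (w.adicCompletion L)]

noncomputable section

section Estimates

variable [IsScalarTower K (v.adicCompletion K) (w.adicCompletion L)]

/-! ### KEY LEMMA 2: the factorisation `Y = (1 + alg c · z)(1 + x')` at level `t` -/

omit [IsScalarTower K (v.adicCompletion K) (w.adicCompletion L)] in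
/-- `v(Y − 1) ≤ exp(−t)` and `v(z) = exp(−t)` (`t ≥ 1`) ⇒ `Y = (1 + alg c · z)(1 + x')` with `c` integral and
`v(x') ≤ exp(−(t+1))`. -/
theorem exists_factor (h2 : Module.finrank (v.adicCompletion K) (w.adicCompletion L) = 2)
    {ϖ : v.adicCompletionIntegers K} (hϖ : Irreducible ϖ) {π : w.adicCompletionIntegers L} (hπ : Irreducible π)
    (hram : ¬ Irreducible (algebraMap (v.adicCompletionIntegers K) (w.adicCompletionIntegers L) ϖ))
    {t : ℕ} (ht1 : 1 ≤ t) {z : w.adicCompletion L} (hz : Valued.v z = WithZero.exp (-(t : ℤ)))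
    {Y : w.adicCompletion L} (hY : Valued.v (Y - 1) ≤ WithZero.exp (-(t : ℤ))) :
    ∃ c : v.adicCompletion K, ∃ x' : w.adicCompletion L, Valued.v c ≤ 1 ∧
      Valued.v x' ≤ WithZero.exp (-((t : ℤ) + 1)) ∧
      Y = (1 + algebraMap (v.adicCompletion K) (w.adicCompletion L) c * z) * (1 + x') := by
  have hz0 : z ≠ 0 := by
    rintro rfl
    rw [map_zero] at hz
    exact WithZero.exp_ne_zero hz.symm
  have hq : Valued.v ((Y - 1) / z) ≤ 1 := by
    rw [map_div₀, hz]
    calc Valued.v (Y - 1) / WithZero.exp (-(t : ℤ)) ≤ WithZero.exp (-(t : ℤ)) / WithZero.exp (-(t : ℤ)) := by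
          gcongr
          exact zero_le
      _ = 1 := div_self (WithZero.exp_ne_zero)
  obtain ⟨a', b', ha', hb', hq'⟩ :=
    exists_eq_algebraMap_add_algebraMap_mul_uniformizer_of_val_le_one v w h2 hϖ hπ hram hq
  have hYeq : Y - 1 = algebraMap (v.adicCompletion K) (w.adicCompletion L) a' * z +
      algebraMap (v.adicCompletion K) (w.adicCompletion L) b' * (π : w.adicCompletion L) * z := by
    have := hq'
    rw [div_eq_iff hz0] at this
    rw [this]
    ring
  set r : w.adicCompletion L :=
    algebraMap (v.adicCompletion K) (w.adicCompletion L) b' * (π : w.adicCompletion L) * z with hr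
  have hrv : Valued.v r ≤ WithZero.exp (-((t : ℤ) + 1)) := by
    rw [hr, map_mul, map_mul, T5AdicCompletionNormGroup.val_uniformizer w hπ, hz]
    calc Valued.v (algebraMap (v.adicCompletion K) (w.adicCompletion L) b') * WithZero.exp (-1) *
          WithZero.exp (-(t : ℤ))
        ≤ 1 * WithZero.exp (-1) * WithZero.exp (-(t : ℤ)) := by
          gcongr
          exact (T5ContinuousValuationExtension.val_algebraMap_le_one_iff b').mpr hb'
      _ = WithZero.exp (-((t : ℤ) + 1)) := by
          rw [one_mul, ← WithZero.exp_add]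
          congr 1
          ring
  have hcz : Valued.v (algebraMap (v.adicCompletion K) (w.adicCompletion L) a' * z) ≤ WithZero.exp (-(t : ℤ)) := by
    rw [map_mul, hz]
    calc Valued.v (algebraMap (v.adicCompletion K) (w.adicCompletion L) a') * WithZero.exp (-(t : ℤ))
        ≤ 1 * WithZero.exp (-(t : ℤ)) := by
          gcongr
          exact (T5ContinuousValuationExtension.val_algebraMap_le_one_iff a').mpr ha'
      _ = WithZero.exp (-(t : ℤ)) := one_mul _
  have hcz1 : Valued.v (algebraMap (v.adicCompletion K) (w.adicCompletion L) a' * z) < Valued.v (1 : w.adicCompletion L) := by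
    rw [map_one]
    refine lt_of_le_of_lt hcz ?_
    rw [← WithZero.exp_zero]
    exact WithZero.exp_lt_exp.mpr (by omega)
  have h1 : Valued.v (1 + algebraMap (v.adicCompletion K) (w.adicCompletion L) a' * z) = 1 := by
    rw [Valuation.map_add_eq_of_lt_left _ hcz1, map_one]
  have h10 : (1 + algebraMap (v.adicCompletion K) (w.adicCompletion L) a' * z) ≠ 0 := by
    intro h
    rw [h, map_zero] at h1
    exact zero_ne_one h1
  refine ⟨a', r / (1 + algebraMap (v.adicCompletion K) (w.adicCompletion L) a' * z), ha', ?_, ?_⟩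
  · rw [map_div₀, h1, div_one]
    exact hrv
  · rw [mul_add, mul_one, mul_div_cancel₀ _ h10]
    linear_combination hYeq

/-! ### The approximation `1 + ϖ^t a₀ ≡ 1 + c A + c² B (mod 𝔪^{t+1})` from `U_F^{(t)} ⊆ N(L_w^×)` -/

/-- `v(Y)² = 1` ⇒ `v(Y) = 1`. -/
theorem val_eq_one_of_sq_eq_one {Y : w.adicCompletion L} (h : Valued.v Y ^ 2 = 1) : Valued.v Y = 1 := by
  have hY0 : Y ≠ 0 := by
    rintro rfl
    rw [map_zero] at h
    simp at h
  have h0 : Valued.v Y ≠ 0 := (Valuation.ne_zero_iff _).mpr hY0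
  rw [← WithZero.exp_log h0, ← WithZero.exp_nsmul, ← WithZero.exp_zero] at h
  have := WithZero.exp_injective h
  rw [← WithZero.exp_log h0, ← WithZero.exp_zero]
  congr 1
  rw [nsmul_eq_mul] at this
  push_cast at this
  omega

/-- THE APPROXIMATION: if `U_F^{(t)} ⊆ N(L_w^×)`, `v(z) = exp(−t)`, `alg A = z + σ z`, `alg B = z σ z` with `v(A), v(B) ≤ 1`,
then every `ϖ^t a₀` (`a₀` integral) is `≡ c A + c² B (mod 𝔪^{t+1})` for some integral `c`. -/
theorem exists_approx (h2 : Module.finrank (v.adicCompletion K) (w.adicCompletion L) = 2)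
    {ϖ : v.adicCompletionIntegers K} (hϖ : Irreducible ϖ) {π : w.adicCompletionIntegers L} (hπ : Irreducible π)
    (hram : ¬ Irreducible (algebraMap (v.adicCompletionIntegers K) (w.adicCompletionIntegers L) ϖ))
    (σ : (w.adicCompletion L) ≃ₐ[v.adicCompletion K] (w.adicCompletion L)) (hσ : σ ≠ 1)
    {i : ℕ} (hi : Valued.v (σ (π : w.adicCompletion L) - π) = WithZero.exp (-(i : ℤ)))
    (e : ℕ) (he : Valued.v (2 : v.adicCompletion K) = WithZero.exp (-(e : ℤ))) (hie : i ≤ 2 * e + 1) (he1 : 1 ≤ e)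
    {t : ℕ} (hti : i = t + 1) (ht1 : 1 ≤ t)
    {z : w.adicCompletion L} (hz : Valued.v z = WithZero.exp (-(t : ℤ))) {A B : v.adicCompletion K}
    (hA : algebraMap (v.adicCompletion K) (w.adicCompletion L) A = z + σ z)
    (hB : algebraMap (v.adicCompletion K) (w.adicCompletion L) B = z * σ z)
    (hvA : Valued.v A ≤ 1) (hvB : Valued.v B ≤ 1)
    (hN : unitFiltration v ϖ t ≤ T5AdicCompletionNormGroup.normGroup v w σ)
    (a₀ : v.adicCompletion K) (ha₀ : Valued.v a₀ ≤ 1) :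
    ∃ c : v.adicCompletion K, Valued.v c ≤ 1 ∧
      Valued.v ((ϖ : v.adicCompletion K) ^ t * a₀ - (c * A + c ^ 2 * B)) ≤ WithZero.exp (-((t : ℤ) + 1)) := by
  set a : v.adicCompletion K := (ϖ : v.adicCompletion K) ^ t * a₀ with ha
  have hva : Valued.v a ≤ WithZero.exp (-(t : ℤ)) := by
    rw [ha, map_mul, map_pow, T5AdicCompletionNormGroup.val_uniformizer v hϖ, ← WithZero.exp_nsmul]
    calc WithZero.exp (t • (-1 : ℤ)) * Valued.v a₀ ≤ WithZero.exp (t • (-1 : ℤ)) * 1 := by gcongr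
      _ = WithZero.exp (-(t : ℤ)) := by
          rw [mul_one]
          congr 1
          rw [nsmul_eq_mul]
          ring
  have hva1 : Valued.v a < Valued.v (1 : v.adicCompletion K) := by
    rw [map_one]
    refine lt_of_le_of_lt hva ?_
    rw [← WithZero.exp_zero]
    exact WithZero.exp_lt_exp.mpr (by omega)
  have hy1 : Valued.v ((1 : v.adicCompletion K) + a) = 1 := by
    rw [Valuation.map_add_eq_of_lt_left _ hva1, map_one]
  have hy0 : (1 : v.adicCompletion K) + a ≠ 0 := by
    intro h
    rw [h, map_zero] at hy1
    exact zero_ne_one hy1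
  set y₀ : (v.adicCompletion K)ˣ := Units.mk0 _ hy0 with hy₀
  have hy₀coe : (y₀ : v.adicCompletion K) = 1 + a := rfl
  have hy₀mem : y₀ ∈ unitFiltration v ϖ t := by
    apply mem_unitFiltration_of_val_sub_one_le v hϖ y₀
    · rw [hy₀coe]
      exact hy1
    · rw [hy₀coe, add_sub_cancel_left]
      exact hva
  have hy₀N := hN hy₀mem
  rw [T5AdicCompletionNormGroup.mem_normGroup_iff] at hy₀N
  obtain ⟨Y, hY⟩ := hy₀N
  rw [hy₀coe] at hY
  have hYv : Valued.v Y = 1 := by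
    apply val_eq_one_of_sq_eq_one w
    rw [← val_mul_algEquiv v w σ Y, hY, T5ContinuousValuationExtension.val_algebraMap_eq_one_iff]
    exact hy1
  have hYt : Valued.v (Y - 1) ≤ WithZero.exp (-(t : ℤ)) := by
    refine val_sub_one_le_of_norm v w h2 hϖ hπ hram σ hi e he hie he1 hti ht1 hYv (u := 1 + a) hY.symm ?_
    rw [add_sub_cancel_left]
    exact hva
  obtain ⟨c, x', hc, hx', hYf⟩ := exists_factor v w h2 hϖ hπ hram ht1 hz hYt
  obtain ⟨u', hu'⟩ := exists_algebraMap_eq_mul_algEquiv v w h2 σ hσ (1 + x')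
  have hu'1 : Valued.v (u' - 1) ≤ WithZero.exp (-((t : ℤ) + 1)) := by
    have := val_norm_sub_one_le v w h2 hϖ hπ hram σ hi e he hie (x := x')
      (by rw [hti]; push_cast; simpa using hx') hu'
    rw [hti] at this
    push_cast at this
    simpa using this
  have hprod : (1 : v.adicCompletion K) + a = (1 + c * A + c ^ 2 * B) * u' := by
    apply (algebraMap (v.adicCompletion K) (w.adicCompletion L)).injective
    rw [map_mul, hu', ← one_add_mul_mul_algEquiv v w σ c z hA hB, ← hY, hYf, map_mul]
    ring
  refine ⟨c, hc, ?_⟩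
  have hsub : (ϖ : v.adicCompletion K) ^ t * a₀ - (c * A + c ^ 2 * B) = (u' - 1) * (1 + c * A + c ^ 2 * B) := by
    rw [← ha]
    linear_combination hprod
  rw [hsub, map_mul]
  have h1cA : Valued.v ((1 : v.adicCompletion K) + c * A + c ^ 2 * B) ≤ 1 := by
    refine le_trans (Valuation.map_add _ _ _) (max_le (le_trans (Valuation.map_add _ _ _) (max_le ?_ ?_)) ?_)
    · rw [map_one]
    · rw [map_mul]
      calc Valued.v c * Valued.v A ≤ 1 * 1 := mul_le_mul' hc hvA
        _ = 1 := one_mul _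
    · rw [map_mul, map_pow]
      calc Valued.v c ^ 2 * Valued.v B ≤ 1 ^ 2 * 1 := by gcongr
        _ = 1 := by simp
  calc Valued.v (u' - 1) * Valued.v ((1 : v.adicCompletion K) + c * A + c ^ 2 * B)
      ≤ WithZero.exp (-((t : ℤ) + 1)) * 1 := by gcongr
    _ = WithZero.exp (-((t : ℤ) + 1)) := mul_one _

/-! ### The residue-field contradiction: `U_F^{(t)} ⊄ N(L_w^×)` -/

/-- THE CONTRADICTION. Given `z` with `v(z) = exp(−t)`, `A = Tr z`, `B = N z` with `v(A) = v(B) = exp(−t)` EXACTLY,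
and `2 ∉ O_{K_v}^×`: `U_F^{(t)} ⊄ N(L_w^×)`. (If it were, `x ↦ ᾱ x + β̄ x²` on the finite residue field would be onto,
hence injective, yet it kills `ᾱ/β̄ ≠ 0` in characteristic `2`.) -/
theorem not_unitFiltration_le_normGroup_of_data
    (h2 : Module.finrank (v.adicCompletion K) (w.adicCompletion L) = 2)
    {ϖ : v.adicCompletionIntegers K} (hϖ : Irreducible ϖ) {π : w.adicCompletionIntegers L} (hπ : Irreducible π)
    (hram : ¬ Irreducible (algebraMap (v.adicCompletionIntegers K) (w.adicCompletionIntegers L) ϖ))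
    (σ : (w.adicCompletion L) ≃ₐ[v.adicCompletion K] (w.adicCompletion L)) (hσ : σ ≠ 1)
    {i : ℕ} (hi : Valued.v (σ (π : w.adicCompletion L) - π) = WithZero.exp (-(i : ℤ)))
    (e : ℕ) (he : Valued.v (2 : v.adicCompletion K) = WithZero.exp (-(e : ℤ))) (hie : i ≤ 2 * e + 1) (he1 : 1 ≤ e)
    {t : ℕ} (hti : i = t + 1) (ht1 : 1 ≤ t) (h2n : ¬ IsUnit (2 : v.adicCompletionIntegers K))
    {z : w.adicCompletion L} (hz : Valued.v z = WithZero.exp (-(t : ℤ))) {A B : v.adicCompletion K}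
    (hA : algebraMap (v.adicCompletion K) (w.adicCompletion L) A = z + σ z)
    (hB : algebraMap (v.adicCompletion K) (w.adicCompletion L) B = z * σ z)
    (hvA : Valued.v A = WithZero.exp (-(t : ℤ))) (hvB : Valued.v B = WithZero.exp (-(t : ℤ))) :
    ¬ unitFiltration v ϖ t ≤ T5AdicCompletionNormGroup.normGroup v w σ := by
  intro hN
  haveI : CharP (IsLocalRing.ResidueField (v.adicCompletionIntegers K)) 2 :=
    T5LocalNormIndex.charP_residueField_two v h2n
  have hϖt : Valued.v ((ϖ : v.adicCompletion K) ^ t) = WithZero.exp (-(t : ℤ)) := by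
    rw [map_pow, T5AdicCompletionNormGroup.val_uniformizer v hϖ, ← WithZero.exp_nsmul]
    congr 1
    rw [nsmul_eq_mul]
    ring
  have hexpt : WithZero.exp (-(t : ℤ)) ≠ 0 := WithZero.exp_ne_zero
  set α : v.adicCompletion K := A / (ϖ : v.adicCompletion K) ^ t with hα
  set β : v.adicCompletion K := B / (ϖ : v.adicCompletion K) ^ t with hβ
  have hαv : Valued.v α = 1 := by
    rw [hα, map_div₀, hvA, hϖt, div_self hexpt]
  have hβv : Valued.v β = 1 := by
    rw [hβ, map_div₀, hvB, hϖt, div_self hexpt]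
  let αO : v.adicCompletionIntegers K := ⟨α, (mem_adicCompletionIntegers _ _ _).mpr hαv.le⟩
  let βO : v.adicCompletionIntegers K := ⟨β, (mem_adicCompletionIntegers _ _ _).mpr hβv.le⟩
  have hαu : IsUnit αO := adicCompletionIntegers.isUnit_iff_valued_eq_one.mpr hαv
  have hβu : IsUnit βO := adicCompletionIntegers.isUnit_iff_valued_eq_one.mpr hβv
  set ρ := IsLocalRing.residue (v.adicCompletionIntegers K) with hρ
  let φ : IsLocalRing.ResidueField (v.adicCompletionIntegers K) →
      IsLocalRing.ResidueField (v.adicCompletionIntegers K) := fun x => x * ρ αO + x ^ 2 * ρ βO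
  have hsurj : Function.Surjective φ := by
    intro y
    obtain ⟨a₀, rfl⟩ := IsLocalRing.residue_surjective y
    have hA1 : Valued.v A ≤ 1 := by
      rw [hvA, ← WithZero.exp_zero]
      exact WithZero.exp_le_exp.mpr (by omega)
    have hB1 : Valued.v B ≤ 1 := by
      rw [hvB, ← WithZero.exp_zero]
      exact WithZero.exp_le_exp.mpr (by omega)
    obtain ⟨c, hc, hcc⟩ := exists_approx v w h2 hϖ hπ hram σ hσ hi e he hie he1 hti ht1 hz hA hB hA1 hB1 hN
      (a₀ : v.adicCompletion K) ((mem_adicCompletionIntegers _ _ _).mp a₀.2)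
    let cO : v.adicCompletionIntegers K := ⟨c, (mem_adicCompletionIntegers _ _ _).mpr hc⟩
    refine ⟨ρ cO, ?_⟩
    show ρ cO * ρ αO + ρ cO ^ 2 * ρ βO = ρ a₀
    rw [← map_mul, ← map_pow, ← map_mul, ← map_add, ← sub_eq_zero, ← map_sub, hρ,
      IsLocalRing.residue_eq_zero_iff, T5AdicCompletionResidueField.mem_maximalIdeal_iff]
    have hcoe : ((cO * αO + cO ^ 2 * βO - a₀ : v.adicCompletionIntegers K) : v.adicCompletion K) =
        c * α + c ^ 2 * β - a₀ := rfl
    rw [hcoe]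
    have hϖt0 : (ϖ : v.adicCompletion K) ^ t ≠ 0 := by
      intro h
      rw [h, map_zero] at hϖt
      exact WithZero.exp_ne_zero hϖt.symm
    have hrew : c * α + c ^ 2 * β - (a₀ : v.adicCompletion K) =
        -(((ϖ : v.adicCompletion K) ^ t * a₀ - (c * A + c ^ 2 * B)) / (ϖ : v.adicCompletion K) ^ t) := by
      rw [hα, hβ]
      field_simp
      ring
    rw [hrew, Valuation.map_neg, map_div₀, hϖt]
    calc Valued.v ((ϖ : v.adicCompletion K) ^ t * a₀ - (c * A + c ^ 2 * B)) / WithZero.exp (-(t : ℤ))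
        ≤ WithZero.exp (-((t : ℤ) + 1)) / WithZero.exp (-(t : ℤ)) := by
          gcongr
          exact zero_le
      _ = WithZero.exp (-1) := by
          rw [← WithZero.exp_sub]
          congr 1
          ring
      _ < 1 := by
          rw [← WithZero.exp_zero]
          exact WithZero.exp_lt_exp.mpr (by norm_num)
  have hinj : Function.Injective φ := Finite.injective_iff_surjective.mpr hsurj
  have hβ0 : ρ βO ≠ 0 := (IsLocalRing.residue_ne_zero_iff_isUnit βO).mpr hβu
  have hα0 : ρ αO ≠ 0 := (IsLocalRing.residue_ne_zero_iff_isUnit αO).mpr hαu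
  have hφ : φ (ρ αO / ρ βO) = 0 := by
    show ρ αO / ρ βO * ρ αO + (ρ αO / ρ βO) ^ 2 * ρ βO = 0
    have e1 : ρ αO / ρ βO * ρ αO + (ρ αO / ρ βO) ^ 2 * ρ βO = ρ αO ^ 2 / ρ βO + ρ αO ^ 2 / ρ βO := by
      field_simp
    rw [e1, CharTwo.add_self_eq_zero]
  have hφ0 : φ 0 = 0 := by
    show (0 : IsLocalRing.ResidueField (v.adicCompletionIntegers K)) * ρ αO + 0 ^ 2 * ρ βO = 0
    ring
  have := hinj (hφ.trans hφ0.symm)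
  rw [div_eq_zero_iff] at this
  rcases this with h | h
  · exact hα0 h
  · exact hβ0 h

end Estimates

end

end Summit.Ventures.HodgeRepro2.T5RamifiedNormBelow
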